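import Summits.HubbardSuperconductivity.HubbardSuperconductivity.Theorems.BalabanIRBirSliceXYOrderRPModes
import HarnessLib

/-!
# Slice order of the anisotropic XY torus (route BalabanIR, support item `BirSliceXYOrderRP`):
# IV. Plancherel on the product torus, the slice sum rule, and the weighted infrared bound on
# the equal-time slice order

Fourth file of the proof of
`Summit.HubbardSuperconductivity.HubbardSuperconductivity.Theses.BalabanIR.BirSliceXYOrderRP`.
For unit two-component spins `ω` on `Λ = (ℤ/L)^d × (ℤ/M)^{d'}` with complex form
`z_p = ω_p⁰ + iω_p¹`, Plancherel in each factor (the tree's `torusFourier_plancherel_holds`) gives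
the SLICE SUM RULE `M^{d'} ∑_t |∑_x z_{(x,t)}|² = |Λ|² - ∑_{k ≠ 0} ∑_q |ẑ(k,q)|²` — the equal-time
slice magnetisations are controlled by the modes with nonzero momentum along the first factor only
(the `k = 0` modes, which soften when `M ≫ L²`, never enter). Translation invariance along the
second factor (a measure-preserving relabelling of `⊗ρ`) makes all slices equivalent, and the
infrared bound per mode of file III then yields
`(M^{d'})² ∫ w |∑_x z_{(x,0)}|² dμ₀ ≥ |Λ|² Z₀ - (|Λ|Z₀/β) ∑_{k≠0}∑_q ε(k,q)⁻¹`
(`slice_integral_lower_bound`), the anisotropic analogue of Friedli–Velenik 2017, (10.39)–(10.41).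

## References
* S. Friedli, Y. Velenik, *Statistical Mechanics of Lattice Systems*, CUP 2017, §10.5.2
  (10.39)–(10.41), Thm. 10.24. [FriedliVelenik2017]
* J. Fröhlich, B. Simon, T. Spencer, Comm. Math. Phys. 50 (1976) 79–95. [FrohlichSimonSpencer1976]
-/

noncomputable section

namespace Summit.HubbardSuperconductivity.HubbardSuperconductivity.Theorems

namespace BirSliceXY

open Finset Literature.Probability.LatticeModels

/-! ### Fourier analysis on the product torus: Plancherel, the slice sum rule, and the
infrared bound on the equal-time slice order -/

section Fourier

open _root_.Complex MeasureTheory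
open scoped ComplexConjugate

variable {d d' L M : ℕ} [NeZero L] [NeZero M]

/-- **Plancherel on `(ℤ/L)^d`** in the form `∑_k |∑_x g_x χ_k(x)|² = L^d ∑_x |g_x|²` (the tree's
`torusFourier_plancherel_holds`, for the conjugate character; Friedli–Velenik 2017, (10.39)). [cite: FriedliVelenik2017, §10.5.2, eq. (10.39)] -/
theorem sum_norm_sq_sum_mul_torusChar (g : TorusSite d L → ℂ) :
    ∑ k, ‖∑ x, g x * torusChar k x‖ ^ 2 = (L : ℝ) ^ d * ∑ x, ‖g x‖ ^ 2 := by
  have h : ∀ k, ∑ x, g x * torusChar k x = conj (torusFourier (fun x => conj (g x)) k) := by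
    intro k
    rw [torusFourier_eq_sum_torusChar, map_sum]
    refine Finset.sum_congr rfl fun x _ => ?_
    rw [map_mul, Complex.conj_conj, Complex.conj_conj]
  simp_rw [h, Complex.norm_conj]
  rw [torusFourier_plancherel_holds (d := d) (L := L) (fun x => conj (g x))]
  simp_rw [Complex.norm_conj]

/-- **Plancherel on the product torus `(ℤ/L)^d × (ℤ/M)^{d'}`** for the product characters
`χ_{k,q}(x,t) = χ_k(x)χ_q(t)`: `∑_{k,q} |∑_p g_p χ_{k,q}(p)|² = L^d M^{d'} ∑_p |g_p|²` (Plancherel in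
each factor). [cite: FriedliVelenik2017, §10.5.2, eq. (10.39)] -/
theorem sum_norm_sq_boxMode (g : TorusSite d L × TorusSite d' M → ℂ) :
    ∑ kq : TorusSite d L × TorusSite d' M,
        ‖∑ p : TorusSite d L × TorusSite d' M, g p * (torusChar kq.1 p.1 * torusChar kq.2 p.2)‖ ^ 2 =
      (L : ℝ) ^ d * (M : ℝ) ^ d' * ∑ p, ‖g p‖ ^ 2 := by
  have inner : ∀ (k : TorusSite d L) (q : TorusSite d' M),
      ∑ p : TorusSite d L × TorusSite d' M, g p * (torusChar k p.1 * torusChar q p.2) =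
        ∑ x, (∑ t, g (x, t) * torusChar q t) * torusChar k x := by
    intro k q
    rw [Fintype.sum_prod_type]
    refine Finset.sum_congr rfl fun x _ => ?_
    rw [Finset.sum_mul]
    refine Finset.sum_congr rfl fun t _ => ?_
    ring
  rw [Fintype.sum_prod_type (f := fun kq : TorusSite d L × TorusSite d' M =>
    ‖∑ p : TorusSite d L × TorusSite d' M, g p * (torusChar kq.1 p.1 * torusChar kq.2 p.2)‖ ^ 2)]
  simp only [inner]
  rw [Finset.sum_comm]
  simp_rw [sum_norm_sq_sum_mul_torusChar]
  rw [← Finset.mul_sum, Finset.sum_comm]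
  simp_rw [sum_norm_sq_sum_mul_torusChar]
  rw [← Finset.mul_sum, Fintype.sum_prod_type (f := fun p : TorusSite d L × TorusSite d' M => ‖g p‖ ^ 2)]
  ring

/-- **Plancherel along the second factor for the zero mode of the first**:
`∑_q |∑_p g_p χ_{0,q}(p)|² = M^{d'} ∑_t |∑_x g(x,t)|²` — the modes with `k = 0` carry exactly the
slice sums. [cite: FriedliVelenik2017, §10.5.2, eq. (10.39)] -/
theorem sum_norm_sq_sliceMode (g : TorusSite d L × TorusSite d' M → ℂ) :
    ∑ q : TorusSite d' M,
        ‖∑ p : TorusSite d L × TorusSite d' M, g p * (torusChar 0 p.1 * torusChar q p.2)‖ ^ 2 =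
      (M : ℝ) ^ d' * ∑ t, ‖∑ x, g (x, t)‖ ^ 2 := by
  have inner : ∀ q : TorusSite d' M,
      ∑ p : TorusSite d L × TorusSite d' M, g p * (torusChar 0 p.1 * torusChar q p.2) =
        ∑ t, (∑ x, g (x, t)) * torusChar q t := by
    intro q
    rw [Fintype.sum_prod_type, Finset.sum_comm]
    refine Finset.sum_congr rfl fun t _ => ?_
    rw [Finset.sum_mul]
    refine Finset.sum_congr rfl fun x _ => ?_
    rw [torusChar_zero_left, one_mul]
  simp only [inner]
  exact sum_norm_sq_sum_mul_torusChar _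

/-- Splitting a sum over the momenta of the product torus into `k = 0` and `k ≠ 0`. [folklore] -/
theorem sum_prod_eq_zero_add {A : Type*} [AddCommMonoid A] (Φ : TorusSite d L × TorusSite d' M → A) :
    ∑ kq, Φ kq = ∑ q, Φ (0, q) + ∑ k ∈ Finset.univ.erase (0 : TorusSite d L), ∑ q, Φ (k, q) := by
  rw [Fintype.sum_prod_type, ← Finset.add_sum_erase _ _ (Finset.mem_univ (0 : TorusSite d L))]

/-- **The slice sum rule** (the anisotropic analogue of Friedli–Velenik 2017, (10.40)): for unit
two-component spins `ω` with complex form `z_p = ω_p^0 + iω_p^1`,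
`M^{d'} ∑_t |∑_x z_{(x,t)}|² = |Λ|² - ∑_{k ≠ 0} ∑_q |∑_p z_p χ_{k,q}(p)|²`: the equal-time slice
magnetisations are controlled by the modes with NONZERO momentum along the first factor only.
[cite: FriedliVelenik2017, §10.5.2, eq. (10.40)] -/
theorem slice_sum_rule (ω : TorusSite d L × TorusSite d' M → Fin 2 → ℝ)
    (hω : ∀ p, ω p 0 ^ 2 + ω p 1 ^ 2 = 1) :
    (M : ℝ) ^ d' * ∑ t : TorusSite d' M, ‖∑ x : TorusSite d L, ((ω (x, t) 0 : ℂ) + (ω (x, t) 1 : ℂ) * I)‖ ^ 2 =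
      ((L : ℝ) ^ d * (M : ℝ) ^ d') ^ 2 -
        ∑ k ∈ Finset.univ.erase (0 : TorusSite d L), ∑ q : TorusSite d' M,
          ‖∑ p : TorusSite d L × TorusSite d' M,
            ((ω p 0 : ℂ) + (ω p 1 : ℂ) * I) * (torusChar k p.1 * torusChar q p.2)‖ ^ 2 := by
  set z : TorusSite d L × TorusSite d' M → ℂ := fun p => (ω p 0 : ℂ) + (ω p 1 : ℂ) * I with hz
  have hz1 : ∀ p, ‖z p‖ ^ 2 = 1 := by
    intro p
    rw [hz]
    simp only
    rw [Complex.sq_norm, Complex.normSq_add_mul_I]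
    exact hω p
  have htot := sum_norm_sq_boxMode z
  simp_rw [hz1] at htot
  rw [Finset.sum_const, Finset.card_univ, nsmul_eq_mul, mul_one, card_boxTorus_real,
    sum_prod_eq_zero_add, sum_norm_sq_sliceMode] at htot
  have hzs : ∀ t : TorusSite d' M, ∑ x : TorusSite d L, z (x, t) =
      ∑ x : TorusSite d L, ((ω (x, t) 0 : ℂ) + (ω (x, t) 1 : ℂ) * I) := fun t => rfl
  simp_rw [hzs] at htot
  linear_combination htot

/-- `|∑_p z_p χ_p|² ≤ 2|∑_p ω_p^0 χ_p|² + 2|∑_p ω_p^1 χ_p|²` for `z = ω^0 + iω^1`. [folklore] -/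
theorem norm_sq_mode_le (ω : TorusSite d L × TorusSite d' M → Fin 2 → ℝ)
    (χ : TorusSite d L × TorusSite d' M → ℂ) :
    ‖∑ p, ((ω p 0 : ℂ) + (ω p 1 : ℂ) * I) * χ p‖ ^ 2 ≤
      2 * ‖∑ p, (ω p 0 : ℂ) * χ p‖ ^ 2 + 2 * ‖∑ p, (ω p 1 : ℂ) * χ p‖ ^ 2 := by
  have hsplit : ∑ p, ((ω p 0 : ℂ) + (ω p 1 : ℂ) * I) * χ p =
      ∑ p, (ω p 0 : ℂ) * χ p + I * ∑ p, (ω p 1 : ℂ) * χ p := by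
    rw [Finset.mul_sum, ← Finset.sum_add_distrib]
    refine Finset.sum_congr rfl fun p _ => ?_
    ring
  rw [hsplit]
  have h1 := norm_add_le (∑ p, (ω p 0 : ℂ) * χ p) (I * ∑ p, (ω p 1 : ℂ) * χ p)
  rw [norm_mul, Complex.norm_I, one_mul] at h1
  have h2 := pow_le_pow_left₀ (norm_nonneg _) h1 2
  nlinarith [sq_nonneg (‖∑ p, (ω p 0 : ℂ) * χ p‖ - ‖∑ p, (ω p 1 : ℂ) * χ p‖)]

/-- **Translations along the second factor preserve the bond energy** of the product torus
(`L, M ≥ 3`): `𝓔(ω ∘ τ_b, ω ∘ τ_b) = 𝓔(ω, ω)` for `τ_b(x,t) = (x, t + b)`. [folklore] -/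
theorem vecGradForm_comp_shift [DecidableRel (torusGraph d L □ torusGraph d' M).Adj] (hL : 3 ≤ L)
    (hM : 3 ≤ M) {ν : ℕ} (ω : TorusSite d L × TorusSite d' M → Fin ν → ℝ) (b : TorusSite d' M) :
    NVector.vecGradForm (torusGraph d L □ torusGraph d' M) (fun p => ω (p.1, p.2 + b))
        (fun p => ω (p.1, p.2 + b)) =
      NVector.vecGradForm (torusGraph d L □ torusGraph d' M) ω ω := by
  rw [NVector.vecGradForm_eq_sum, NVector.vecGradForm_eq_sum, sum_edgeFinset_boxTorus hL hM,
    sum_edgeFinset_boxTorus hL hM]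
  simp only [Sym2.lift_mk]
  have h : ∀ (p : TorusSite d L × TorusSite d' M) (j : Fin d'),
      p.2 + Pi.single j 1 + b = p.2 + b + Pi.single j 1 := fun p j => add_right_comm _ _ _
  simp_rw [h]
  refine Fintype.sum_equiv ((Equiv.refl (TorusSite d L)).prodCongr (Equiv.addRight b)) _ _
    fun p => ?_
  obtain ⟨x, s⟩ := p
  rfl

/-- **Equal-time slice expectations do not depend on the slice**: the Boltzmann-weighted integral
of `|∑_x z_{(x,t)}|²` against the product reference measure is the same for every `t`
(translation invariance along the second factor: the translation is a measure-preserving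
relabelling of the product measure, Mathlib's `measurePreserving_piCongrLeft`, and preserves the
bond energy). [folklore] -/
theorem integral_sliceSum_shift [DecidableRel (torusGraph d L □ torusGraph d' M).Adj] (hL : 3 ≤ L)
    (hM : 3 ≤ M) (ρ : Measure (Fin 2 → ℝ)) [SigmaFinite ρ] (β : ℝ) (t : TorusSite d' M) :
    ∫ ω, Real.exp (-β * NVector.vecGradForm (torusGraph d L □ torusGraph d' M) ω ω) *
        ‖∑ x : TorusSite d L, ((ω (x, t) 0 : ℂ) + (ω (x, t) 1 : ℂ) * I)‖ ^ 2
          ∂(Measure.pi fun _ : TorusSite d L × TorusSite d' M => ρ) =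
      ∫ ω, Real.exp (-β * NVector.vecGradForm (torusGraph d L □ torusGraph d' M) ω ω) *
        ‖∑ x : TorusSite d L, ((ω (x, 0) 0 : ℂ) + (ω (x, 0) 1 : ℂ) * I)‖ ^ 2
          ∂(Measure.pi fun _ : TorusSite d L × TorusSite d' M => ρ) := by
  set e : (TorusSite d L × TorusSite d' M) ≃ (TorusSite d L × TorusSite d' M) :=
    (Equiv.refl (TorusSite d L)).prodCongr (Equiv.addRight t) with he
  have hΦ : MeasurePreserving
      (MeasurableEquiv.piCongrLeft (fun _ : TorusSite d L × TorusSite d' M => Fin 2 → ℝ) e).symm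
      (Measure.pi fun _ : TorusSite d L × TorusSite d' M => ρ)
      (Measure.pi fun _ : TorusSite d L × TorusSite d' M => ρ) :=
    (measurePreserving_piCongrLeft (fun _ : TorusSite d L × TorusSite d' M => ρ) e).symm
  have hΦω : ∀ ω : TorusSite d L × TorusSite d' M → Fin 2 → ℝ,
      ((MeasurableEquiv.piCongrLeft (fun _ : TorusSite d L × TorusSite d' M => Fin 2 → ℝ) e).symm ω) =
        fun p => ω (p.1, p.2 + t) := by
    intro ω
    funext p
    rw [← MeasurableEquiv.coe_toEquiv_symm, MeasurableEquiv.piCongrLeft]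
    simp only [Equiv.piCongrLeft_symm_apply, he, Equiv.prodCongr_apply, Equiv.coe_refl,
      Equiv.coe_addRight]
    rfl
  refine Eq.trans ?_ (hΦ.integral_comp' (fun ω : TorusSite d L × TorusSite d' M → Fin 2 → ℝ =>
    Real.exp (-β * NVector.vecGradForm (torusGraph d L □ torusGraph d' M) ω ω) *
      ‖∑ x : TorusSite d L, ((ω (x, 0) 0 : ℂ) + (ω (x, 0) 1 : ℂ) * I)‖ ^ 2))
  refine integral_congr_ae (ae_of_all _ fun ω => ?_)
  simp only [hΦω]
  rw [vecGradForm_comp_shift hL hM ω t, zero_add]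

/-- **Infrared lower bound for the equal-time slice order, weighted form** (Friedli–Velenik 2017,
Thm. 10.24 with (10.39)–(10.40), anisotropic version): on the even product torus
`Λ = (ℤ/L)^d × (ℤ/M)^{d'}` (`L, M ≥ 4`), for unit two-component spins with single-spin law `ρ`,
Boltzmann weight `w = e^{-β𝓔(ω,ω)}` (`β > 0`) and reference measure `μ₀ = ⊗ρ`,
`(M^{d'})² ∫ w |∑_x z_{(x,0)}|² dμ₀ ≥ |Λ|² Z₀ - (|Λ| Z₀/β) ∑_{k≠0} ∑_q ε(k,q)⁻¹`, `Z₀ = ∫ w dμ₀`: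
slice-independence, the slice sum rule, `|ẑ|² ≤ 2|ω̂⁰|² + 2|ω̂¹|²`, and the infrared bound
`4βε ∫ w|ω̂^a|² ≤ |Λ| Z₀` for each mode with `k ≠ 0`. [cite: FriedliVelenik2017, Thm. 10.24 and §10.5.2] -/
theorem slice_integral_lower_bound [DecidableRel (torusGraph d L □ torusGraph d' M).Adj]
    (hL : Even L) (hL4 : 4 ≤ L) (hM : Even M) (hM4 : 4 ≤ M) (ρ : Measure (Fin 2 → ℝ))
    [IsFiniteMeasure ρ] {K : Set (Fin 2 → ℝ)} (hKc : IsCompact K) (hK : ρ Kᶜ = 0) (hρ : ρ ≠ 0)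
    (hunit : ∀ᵐ s ∂ρ, s 0 ^ 2 + s 1 ^ 2 = 1) {β : ℝ} (hβ : 0 < β) :
    ((L : ℝ) ^ d * (M : ℝ) ^ d') ^ 2 *
        (∫ ω, Real.exp (-β * NVector.vecGradForm (torusGraph d L □ torusGraph d' M) ω ω)
          ∂(Measure.pi fun _ : TorusSite d L × TorusSite d' M => ρ)) -
      (L : ℝ) ^ d * (M : ℝ) ^ d' *
        (∫ ω, Real.exp (-β * NVector.vecGradForm (torusGraph d L □ torusGraph d' M) ω ω)
          ∂(Measure.pi fun _ : TorusSite d L × TorusSite d' M => ρ)) / β *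
        ∑ k ∈ Finset.univ.erase (0 : TorusSite d L), ∑ q : TorusSite d' M,
          1 / (dispersion (latticeMomentum L k) + dispersion (latticeMomentum M q)) ≤
    ((M : ℝ) ^ d') ^ 2 *
      ∫ ω, Real.exp (-β * NVector.vecGradForm (torusGraph d L □ torusGraph d' M) ω ω) *
        ‖∑ x : TorusSite d L, ((ω (x, 0) 0 : ℂ) + (ω (x, 0) 1 : ℂ) * I)‖ ^ 2
          ∂(Measure.pi fun _ : TorusSite d L × TorusSite d' M => ρ) := by
  have hL3 : 3 ≤ L := by omega
  have hM3 : 3 ≤ M := by omega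
  set μ₀ : Measure (TorusSite d L × TorusSite d' M → Fin 2 → ℝ) :=
    Measure.pi fun _ : TorusSite d L × TorusSite d' M => ρ with hμ₀
  set w : (TorusSite d L × TorusSite d' M → Fin 2 → ℝ) → ℝ := fun ω =>
    Real.exp (-β * NVector.vecGradForm (torusGraph d L □ torusGraph d' M) ω ω) with hw
  set N : ℝ := (L : ℝ) ^ d * (M : ℝ) ^ d' with hN
  set Z₀ : ℝ := ∫ ω, w ω ∂μ₀ with hZ₀
  set sl : (TorusSite d L × TorusSite d' M → Fin 2 → ℝ) → TorusSite d' M → ℂ := fun ω t =>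
    ∑ x : TorusSite d L, ((ω (x, t) 0 : ℂ) + (ω (x, t) 1 : ℂ) * I) with hsl
  set md : (TorusSite d L × TorusSite d' M → Fin 2 → ℝ) → TorusSite d L → TorusSite d' M → ℂ :=
    fun ω k q => ∑ p : TorusSite d L × TorusSite d' M,
      ((ω p 0 : ℂ) + (ω p 1 : ℂ) * I) * (torusChar k p.1 * torusChar q p.2) with hmd
  set mc : (TorusSite d L × TorusSite d' M → Fin 2 → ℝ) → Fin 2 → TorusSite d L → TorusSite d' M → ℂ :=
    fun ω a k q => ∑ p : TorusSite d L × TorusSite d' M,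
      (ω p a : ℂ) * (torusChar k p.1 * torusChar q p.2) with hmc
  set S : ℝ := ∑ k ∈ Finset.univ.erase (0 : TorusSite d L), ∑ q : TorusSite d' M,
    1 / (dispersion (latticeMomentum L k) + dispersion (latticeMomentum M q)) with hS
  show N ^ 2 * Z₀ - N * Z₀ / β * S ≤ ((M : ℝ) ^ d') ^ 2 * ∫ ω, w ω * ‖sl ω 0‖ ^ 2 ∂μ₀
  have hwc : Continuous w :=
    ((NVector.continuous_vecGradForm_self (G := torusGraph d L □ torusGraph d' M)).const_mul (-β)).rexp
  have hint : ∀ {f : (TorusSite d L × TorusSite d' M → Fin 2 → ℝ) → ℝ}, Continuous f →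
      Integrable f μ₀ := fun hf => NVector.integrable_pi_of_continuous ρ hKc hK hf
  have hslc : ∀ t, Continuous fun ω => ‖sl ω t‖ ^ 2 := by intro t; rw [hsl]; fun_prop
  have hmdc : ∀ k q, Continuous fun ω => ‖md ω k q‖ ^ 2 := by intro k q; rw [hmd]; fun_prop
  have hmcc : ∀ a k q, Continuous fun ω => ‖mc ω a k q‖ ^ 2 := by intro a k q; rw [hmc]; fun_prop
  have hIsl : ∀ t, Integrable (fun ω => w ω * ‖sl ω t‖ ^ 2) μ₀ := fun t => hint (hwc.mul (hslc t))
  have hImd : ∀ k q, Integrable (fun ω => w ω * ‖md ω k q‖ ^ 2) μ₀ :=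
    fun k q => hint (hwc.mul (hmdc k q))
  have hImc : ∀ a k q, Integrable (fun ω => w ω * ‖mc ω a k q‖ ^ 2) μ₀ :=
    fun a k q => hint (hwc.mul (hmcc a k q))
  have hw0 : ∀ ω, 0 < w ω := fun ω => Real.exp_pos _
  have hZ₀pos : 0 < Z₀ := by
    have := NVector.vZ_pos (G := torusGraph d L □ torusGraph d' M) hρ hβ.le
      (0 : TorusSite d L × TorusSite d' M → Fin 2 → ℝ)
    rwa [NVector.vZ_zero] at this
  -- Step A: slice independence, `(M^{d'})² I₀ = M^{d'} ∑_t I_t = ∫ w · M^{d'} ∑_t |sl_t|²`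
  have hA : ((M : ℝ) ^ d') ^ 2 * ∫ ω, w ω * ‖sl ω 0‖ ^ 2 ∂μ₀ =
      ∫ ω, w ω * ((M : ℝ) ^ d' * ∑ t, ‖sl ω t‖ ^ 2) ∂μ₀ := by
    have h1 : ∀ t, ∫ ω, w ω * ‖sl ω t‖ ^ 2 ∂μ₀ = ∫ ω, w ω * ‖sl ω 0‖ ^ 2 ∂μ₀ := fun t =>
      integral_sliceSum_shift hL3 hM3 ρ β t
    have h2 : ∫ ω, w ω * ((M : ℝ) ^ d' * ∑ t, ‖sl ω t‖ ^ 2) ∂μ₀ =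
        (M : ℝ) ^ d' * ∑ t : TorusSite d' M, ∫ ω, w ω * ‖sl ω t‖ ^ 2 ∂μ₀ := by
      rw [← integral_finsetSum _ fun t _ => hIsl t, ← integral_const_mul]
      refine integral_congr_ae (ae_of_all _ fun ω => ?_)
      simp only
      rw [Finset.mul_sum, Finset.mul_sum, Finset.mul_sum]
      exact Finset.sum_congr rfl fun t _ => by ring
    rw [h2]
    simp_rw [h1]
    rw [Finset.sum_const, Finset.card_univ, nsmul_eq_mul, NVector.card_torusSite_real]
    ring
  -- Step B: the slice sum rule, integrated
  have hae : ∀ᵐ ω ∂μ₀, ∀ p : TorusSite d L × TorusSite d' M, ω p 0 ^ 2 + ω p 1 ^ 2 = 1 :=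
    NVector.ae_pi_forall (ι := TorusSite d L × TorusSite d' M) ρ hunit
  have hB : ∫ ω, w ω * ((M : ℝ) ^ d' * ∑ t, ‖sl ω t‖ ^ 2) ∂μ₀ =
      N ^ 2 * Z₀ - ∑ k ∈ Finset.univ.erase (0 : TorusSite d L), ∑ q : TorusSite d' M,
        ∫ ω, w ω * ‖md ω k q‖ ^ 2 ∂μ₀ := by
    have h1 : ∫ ω, w ω * ((M : ℝ) ^ d' * ∑ t, ‖sl ω t‖ ^ 2) ∂μ₀ =
        ∫ ω, (N ^ 2 * w ω - ∑ k ∈ Finset.univ.erase (0 : TorusSite d L), ∑ q : TorusSite d' M,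
          w ω * ‖md ω k q‖ ^ 2) ∂μ₀ := by
      refine integral_congr_ae ?_
      filter_upwards [hae] with ω hω
      rw [slice_sum_rule ω hω, mul_sub, Finset.mul_sum]
      congr 1
      · ring
      · exact Finset.sum_congr rfl fun k _ => by rw [Finset.mul_sum]
    have hIin : ∀ k, Integrable (fun ω => ∑ q : TorusSite d' M, w ω * ‖md ω k q‖ ^ 2) μ₀ :=
      fun k => integrable_finsetSum _ fun q _ => hImd k q
    have hIout : Integrable (fun ω => ∑ k ∈ Finset.univ.erase (0 : TorusSite d L),
        ∑ q : TorusSite d' M, w ω * ‖md ω k q‖ ^ 2) μ₀ :=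
      integrable_finsetSum _ fun k _ => hIin k
    rw [h1, integral_sub ((hint hwc).const_mul _) hIout, integral_const_mul,
      integral_finsetSum _ fun k _ => hIin k]
    congr 1
    exact Finset.sum_congr rfl fun k _ => integral_finsetSum _ fun q _ => hImd k q
  -- Step C: the infrared bound on each mode with `k ≠ 0`
  have hC : ∀ k ∈ Finset.univ.erase (0 : TorusSite d L), ∀ q : TorusSite d' M,
      ∫ ω, w ω * ‖md ω k q‖ ^ 2 ∂μ₀ ≤
        N * Z₀ / β * (1 / (dispersion (latticeMomentum L k) + dispersion (latticeMomentum M q))) := by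
    intro k hk q
    have hk0 : k ≠ 0 := Finset.ne_of_mem_erase hk
    set ε : ℝ := dispersion (latticeMomentum L k) + dispersion (latticeMomentum M q) with hε
    have hεk : 0 < dispersion (latticeMomentum L k) :=
      lt_of_le_of_ne (dispersion_nonneg _)
        (fun h => hk0 ((dispersion_latticeMomentum_eq_zero_iff_holds k).1 h.symm))
    have hεpos : 0 < ε := add_pos_of_pos_of_nonneg hεk (dispersion_nonneg _)
    have hmode : ∀ a : Fin 2, 4 * β * ε * ∫ ω, w ω * ‖mc ω a k q‖ ^ 2 ∂μ₀ ≤ N * Z₀ := by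
      intro a
      have := weighted_mode_bound_box hL hL4 hM hM4 ρ hKc hK hρ hβ k q hεpos a
      rw [card_boxTorus_real] at this
      exact this
    have hle : ∫ ω, w ω * ‖md ω k q‖ ^ 2 ∂μ₀ ≤
        2 * ∫ ω, w ω * ‖mc ω 0 k q‖ ^ 2 ∂μ₀ + 2 * ∫ ω, w ω * ‖mc ω 1 k q‖ ^ 2 ∂μ₀ := by
      rw [← integral_const_mul, ← integral_const_mul,
        ← integral_add ((hImc 0 k q).const_mul _) ((hImc 1 k q).const_mul _)]
      refine integral_mono (hImd k q) (((hImc 0 k q).const_mul _).add ((hImc 1 k q).const_mul _))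
        fun ω => ?_
      have := norm_sq_mode_le ω (fun p => torusChar k p.1 * torusChar q p.2)
      have hw' := (hw0 ω).le
      simp only
      nlinarith
    have h0 := hmode 0
    have h1 := hmode 1
    rw [mul_one_div, le_div_iff₀ hεpos, le_div_iff₀ hβ]
    have h2 : (∫ ω, w ω * ‖md ω k q‖ ^ 2 ∂μ₀) * ε * β ≤
        (2 * ∫ ω, w ω * ‖mc ω 0 k q‖ ^ 2 ∂μ₀ + 2 * ∫ ω, w ω * ‖mc ω 1 k q‖ ^ 2 ∂μ₀) * ε * β :=
      mul_le_mul_of_nonneg_right (mul_le_mul_of_nonneg_right hle hεpos.le) hβ.le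
    linarith
  -- Step D: assemble
  have hsum : ∑ k ∈ Finset.univ.erase (0 : TorusSite d L), ∑ q : TorusSite d' M,
      ∫ ω, w ω * ‖md ω k q‖ ^ 2 ∂μ₀ ≤ N * Z₀ / β * S := by
    rw [hS, Finset.mul_sum]
    refine Finset.sum_le_sum fun k hk => ?_
    rw [Finset.mul_sum]
    exact Finset.sum_le_sum fun q _ => hC k hk q
  rw [hA, hB]
  linarith

end Fourier

end BirSliceXY

end Summit.HubbardSuperconductivity.HubbardSuperconductivity.Theorems
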